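/-
Origin: expansion seat `planner-pub-hodgecm-mc-axioms-1-g14-0`, handover #W57 2026-08-20T15:53:55Z md5 3d882ef58093 (PKG a0359cbbc5aa → 3d882ef58093; 368 l.; MECHANICAL (iib-R) rewrite v3.1 of the PKG file as it stands (14 token edits; rules R1x1+RX[h₂']x13)) (`HOME/mc/pub-hodgecm-mc-axioms-1-g14/revendor/kit-r55/stage55/HodgeCM/Model/ArchKTypeOfAt.lean`, md5 3d882ef58093, 368 lines);
landed by the gen-22 packager (p-g22) in gate run 55 REPLACES the earlier landed copy of `HodgeCM/Model/ArchKTypeOfAt.lean` (seat copy carried the packager Origin header of an earlier run (stripped)).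
-/
/-
Copyright (c) 2026. Released under Apache 2.0 license as described in the file LICENSE.
Cell pub-hodgecm, MODEL layer (construction prover mc-carch-1, gen 4), BINDER-OWNERS row 12 `C` in binder-1's CENTRE-FREE currency
`ArchKTypeDataAt` (#51): the constructor at an arbitrary rational centre, its saturation-group fixing, and the (AN)/(REP) junction lemmas.
-/
import Summits.HodgeConjecture.HodgeCM.Model.ArchKTypeOf
import Summits.HodgeConjecture.HodgeCM.Model.ArchKTypeOfFix
import Summits.HodgeConjecture.HodgeCM.Model.ArchKTypeJunction
import Summits.HodgeConjecture.HodgeCM.Model.Binders.ArchKTypeAt_2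

/-!
# The archimedean `K`-type datum AT AN ARBITRARY CENTRE: `archKTypeOfAt`

binder-1 #51 `ArchKTypeDataAt X k xc 𝔫` replaces the base point `(X.P k).x₀` of `ArchKTypeData` by a thin coset `xc + 𝔫𝒪̂` ((W-0) needs
every rational centre).  This leaf supplies, for the C lane's towers:

* § 1 `satLevel_fix_of_arch_of_fin_family` — #CA5 `satLevel_fix_of_arch_of_fin` for an ARBITRARY family of vectors (the thin-coset test
  functions at any centre): every element of `satLevelRegimeOf V hV K` fixes the family once its archimedean-away-from-`ι₁` factor
  (`harch`) and its finite factor in `K` (`hfin`) do;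
* § 2 the (AN)/(REP) junction lemmas of theta-3's `ArchKTypeJunction` VERBATIM for `ArchKTypeDataAt` (`isWeaklyPDiff_of_junction`,
  `isPMinusKilledAlong_of_junction(')`, `isWeaklyPDiff_of_blockPair`, `isPMinusKilledAlong_of_blockPair` — the predicates are binder-1's
  verbatim copies, so are the proofs);
* § 3 **`archKTypeOfAt S hV k x N Γ₀ K hK hlevel hsat ωA hA Φarch hfix harm : ArchKTypeDataAt (thetaSpaceInputIn … S hV) k (finEmb x) (N)`**
  — the centre-free twin of #CA1v4 `archKTypeOf`: `ωinf := ωA` (no read-off needed), `prodN` = #CA2's product identity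
  `apply_testFun_of_eq_adelicTensorEnd` at the centre `x`, `fixN := hfix` (at `x`), `harm` as given; field lemmas and the rows-14/15
  transfers `isWeaklyPDiff_archKTypeOfAt` / `isPMinusKilledAlong_archKTypeOfAt` (hypotheses on `(ωA, Φarch)` only).

Nothing is cited and nothing is minted; 0 records, 0 `def … : Prop`.
-/

set_option autoImplicit false

noncomputable section

open Filter Topology Complex
open scoped Classical SchwartzMap
open MulAction NumberField NumberField.mixedEmbedding IsDedekindDomain
open Literature.NumberTheory.Automorphic Literature.NumberTheory.Automorphic.UnitaryGroup Literature.NumberTheory.Weil1964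
open Literature.Analysis.SegalBargmann
open Literature.AlgebraicGeometry.HodgeTheory
open Literature.AlgebraicGeometry.ShimuraVarieties Literature.AlgebraicGeometry.ShimuraVarieties.BallForms
open Literature.Geometry.ComplexHyperbolic.BallModel
open Literature.RepresentationTheory.KonnoKonno2007 Literature.RepresentationTheory.KonnoKonno2007.RealDualPair
open Literature.NumberTheory.Automorphic.PicardCM Literature.Analysis.Distribution
open Literature.RepresentationTheory.HeisenbergGroup
open HodgeCM.PerL34.Seesaw HodgeCM.PerL34.RationalCoset HodgeCM.PerL34.SupplyAdelic
open HodgeCM.Model.SupplyInstance HodgeCM.Model.SupplyResidual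
open HodgeCM.Model.ThetaSpace

namespace HodgeCM
namespace Model

/-! ## § 1 The saturation group fixes any family its two factors fix -/

section Fix

variable {L : CMField} {ι₁ : L →+* ℂ} {V : HermSpace3 L ι₁} {c : SeesawCtx L}
  (S : ThetaAdelicSide V c) (hV : IsAnisotropic L V.Hm) (k : Fin 4)
  (K : Subgroup (UnitaryGroup.finAdelic (↥(maximalRealSubfield L)) L (IsCMField.complexConj L) 3 V.Hm))
  {ιF : Type*} (F : ιF → piSchwartzBruhat (↥(maximalRealSubfield L)) (Fin 3))

/-- **#CA5 for an arbitrary family of vectors**: if the archimedean elements away from `ι₁` and the finite elements of `K` fix every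
`F i`, so does every element of `satLevelRegimeOf V hV K`. -/
theorem satLevel_fix_of_arch_of_fin_family
    (harch : ∀ a : UnitaryGroup.arch (↥(maximalRealSubfield L)) L (IsCMField.complexConj L) 3 V.Hm,
      UnitaryGroup.archAt (↥(maximalRealSubfield L)) L (IsCMField.complexConj L) 3 V.Hm (UnitaryGroup.cmPlace (L : Type) ι₁)
          (NumberField.complexConj_smul_infinitePlace (L : Type) _) (IsCMField.complexConj_ne_one (L : Type)) a = 1 →
      ∀ i, (S.P k).ω (HodgeCM.Adelic.regimeEquiv L V.Hm hV
          (UnitaryGroup.archToAdelic (↥(maximalRealSubfield L)) L (IsCMField.complexConj L) 3 V.Hm a), 1) (F i) = F i)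
    (hfin : ∀ kf : UnitaryGroup.finAdelic (↥(maximalRealSubfield L)) L (IsCMField.complexConj L) 3 V.Hm, kf ∈ K →
      ∀ i, (S.P k).ω (HodgeCM.Adelic.regimeEquiv L V.Hm hV
          (UnitaryGroup.finAdelicToAdelic (↥(maximalRealSubfield L)) L (IsCMField.complexConj L) 3 V.Hm kf), 1) (F i) = F i) :
    ∀ x : (V.latticeModel printFact_unitaryCompact_holds).G,
      x ∈ (satLevelRegimeOf V hV K : Subgroup (V.latticeModel printFact_unitaryCompact_holds).G) →
      ∀ i, (S.P k).ω (x, 1) (F i) = F i := by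
  rintro _ ⟨g, hg, rfl⟩ i
  have hg' : g ∈ satLevelOf V K := hg
  obtain ⟨hga, hgf⟩ := Subgroup.mem_inf.1 hg'
  -- `g = (g_∞, 1) · (1, g_f)` with `(g_∞)_{w(ι₁)} = 1` and `g_f ∈ K`
  have hsplit := UnitaryGroup.archToAdelic_mul_finAdelicToAdelic (↥(maximalRealSubfield L)) L (IsCMField.complexConj L) 3
    V.Hm g
  have ha : UnitaryGroup.archAt (↥(maximalRealSubfield L)) L (IsCMField.complexConj L) 3 V.Hm
      (UnitaryGroup.cmPlace (L : Type) ι₁) (NumberField.complexConj_smul_infinitePlace (L : Type) _)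
      (IsCMField.complexConj_ne_one (L : Type))
      (UnitaryGroup.archPart (↥(maximalRealSubfield L)) L (IsCMField.complexConj L) 3 V.Hm g) = 1 :=
    (UnitaryGroup.mem_awayFrom_iff (↥(maximalRealSubfield L)) L (IsCMField.complexConj L) 3 V.Hm
      (IsCMField.complexConj_ne_one (L : Type)) (NumberField.complexConj_smul_infinitePlace (L : Type))
      (UnitaryGroup.cmPlace (L : Type) ι₁) g).1 hga
  have hf : UnitaryGroup.finPart (↥(maximalRealSubfield L)) L (IsCMField.complexConj L) 3 V.Hm g ∈ K :=
    (mem_cmSplitLevel_iff (L : Type) 3 V.Hm K g).1 hgf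
  have hsplit' : (HodgeCM.Adelic.regimeEquiv L V.Hm hV).toMonoidHom g =
      HodgeCM.Adelic.regimeEquiv L V.Hm hV
          (UnitaryGroup.archToAdelic (↥(maximalRealSubfield L)) L (IsCMField.complexConj L) 3 V.Hm
            (UnitaryGroup.archPart (↥(maximalRealSubfield L)) L (IsCMField.complexConj L) 3 V.Hm g)) *
        HodgeCM.Adelic.regimeEquiv L V.Hm hV
          (UnitaryGroup.finAdelicToAdelic (↥(maximalRealSubfield L)) L (IsCMField.complexConj L) 3 V.Hm
            (UnitaryGroup.finPart (↥(maximalRealSubfield L)) L (IsCMField.complexConj L) 3 V.Hm g)) := by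
    rw [← map_mul]
    exact congrArg (HodgeCM.Adelic.regimeEquiv L V.Hm hV) hsplit.symm
  let ρ' : ↥(HodgeCM.Adelic.regimeSubgroup L V.Hm) →*
      Module.End ℂ ↥(piSchwartzBruhat (↥(maximalRealSubfield L)) (Fin 3)) :=
    (S.P k).ω.comp (MonoidHom.inl _ _)
  have e1 : ∀ x : ↥(HodgeCM.Adelic.regimeSubgroup L V.Hm), (S.P k).ω (x, 1) = ρ' x := fun _ => rfl
  rw [e1, hsplit', map_mul ρ', Module.End.mul_apply, ← e1, ← e1, hfin _ hf, harch _ ha]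


end Fix

/-! ## § 2 The (AN)/(REP) junction lemmas for `ArchKTypeDataAt` (theta-3 `ArchKTypeJunction`, verbatim) -/

section ArchJunction

variable {U : Universe} {Lc : CMField} {ι₁ : Lc →+* ℂ} {V : HermSpace3 Lc ι₁} {c : SeesawCtx Lc}

namespace ArchKTypeDataAt

variable {X : ThetaSpaceInput U V c} {k : Fin 4} {xc : X.J → FiniteAdeleRing (𝓞 X.K) X.K} {𝔫 : Ideal (𝓞 X.K)}
  (B : ArchKTypeDataAt X k xc 𝔫)
variable {R S : Type} [Fintype R] [DecidableEq R] [Fintype S] [DecidableEq S]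

set_option backward.isDefEq.respectTransparency false in
/-- **(AN) for an archimedean `K`-type datum intertwined with a twisted junction datum** along any chart
`e : ℂ² → G₁` factoring through `b ↦ (u21FrameEquiv (expP b), 1)` on the harmonic vectors. -/
theorem isWeaklyPDiff_of_junction
    {ω₁ : Representation ℂ (Ginf (Fin 2) Unit R S) (SchwartzMap (DPIdx (Fin 2) Unit R S → ℝ) ℂ)}
    (hW₁ : IsArchWeilDatum (ι𝕎 (Fin 2) Unit R S) ω₁) {ev : VacExponents}
    (hvac₁ : ∀ kk : DPK (Fin 2) Unit R S, ω₁ (κ (Fin 2) Unit R S kk) (hermitePi 0) = vacScalar ev kk • hermitePi 0)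
    (χc : Ginf (Fin 2) Unit R S →* Circle) (hχc : Continuous χc)
    (e : (Fin 2 → ℂ) → X.G₁)
    (L : SchwartzMap (DPIdx (Fin 2) Unit R S → ℝ) ℂ →L[ℂ] 𝓢((X.J → mixedSpace X.K), ℂ))
    (Φ₁ : Module.Dual ℂ X.W → SchwartzMap (DPIdx (Fin 2) Unit R S → ℝ) ℂ)
    (hΦ : ∀ ℓ, B.Φarch ℓ = L (Φ₁ ℓ))
    (hω : ∀ (b : Fin 2 → ℂ) (ℓ : Module.Dual ℂ X.W), B.ωinf (e b) (L (Φ₁ ℓ)) =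
      L (charTwist (Circle.coeHom.comp χc) ω₁
        (((u21FrameEquiv (expP b) : UForm (Fin 2) Unit), (1 : UForm R S)) : Ginf (Fin 2) Unit R S) (Φ₁ ℓ))) :
    B.IsWeaklyPDiff e := by
  intro T ℓ
  have hχ : Continuous (Circle.coeHom.comp χc : Ginf (Fin 2) Unit R S →* ℂ) := continuous_subtype_val.comp hχc
  have h := differentiableAt_charTwist_expP (V := ℂ) hW₁ hvac₁ hχ ((T.comp L).restrictScalars ℝ) (Φ₁ ℓ) 0
  refine h.congr_of_eventuallyEq (Filter.Eventually.of_forall fun b => ?_)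
  simp only [hΦ, hω, ContinuousLinearMap.coe_restrictScalars', ContinuousLinearMap.coe_comp,
    Function.comp_apply]

set_option backward.isDefEq.respectTransparency false in
/-- **(REP) along `-i e_p` for an archimedean `K`-type datum intertwined with a twisted junction datum**, from the
harmonicity relation of the local vectors. -/
theorem isPMinusKilledAlong_of_junction
    {ω₁ : Representation ℂ (Ginf (Fin 2) Unit R S) (SchwartzMap (DPIdx (Fin 2) Unit R S → ℝ) ℂ)}
    (hW₁ : IsArchWeilDatum (ι𝕎 (Fin 2) Unit R S) ω₁)
    (χc : Ginf (Fin 2) Unit R S →* Circle) (hχc : Continuous χc)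
    (e : (Fin 2 → ℂ) → X.G₁)
    (L : SchwartzMap (DPIdx (Fin 2) Unit R S → ℝ) ℂ →L[ℂ] 𝓢((X.J → mixedSpace X.K), ℂ))
    (Φ₁ : Module.Dual ℂ X.W → SchwartzMap (DPIdx (Fin 2) Unit R S → ℝ) ℂ)
    (hΦ : ∀ ℓ, B.Φarch ℓ = L (Φ₁ ℓ))
    (hω : ∀ (b : Fin 2 → ℂ) (ℓ : Module.Dual ℂ X.W), B.ωinf (e b) (L (Φ₁ ℓ)) =
      L (charTwist (Circle.coeHom.comp χc) ω₁
        (((u21FrameEquiv (expP b) : UForm (Fin 2) Unit), (1 : UForm R S)) : Ginf (Fin 2) Unit R S) (Φ₁ ℓ)))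
    (p : Fin 2)
    (hf : ∀ ℓ, hypOpGen R S p () (Φ₁ ℓ) + I • rotBoostGen R S p () (Real.pi / 2) (Φ₁ ℓ) = 0) :
    B.IsPMinusKilledAlong e (-Complex.I • (Pi.single p 1 : Fin 2 → ℂ)) := by
  intro ℓ
  obtain ⟨D, Dᵢ, h₁, h₂, h₃⟩ := weilDatum_pMinus_expP_map (hW₁.twist χc hχc) p (Φ₁ ℓ) (hf ℓ) L
  refine ⟨D, Dᵢ, ?_, ?_, h₃⟩
  · simpa only [hΦ, hω] using h₁
  · simpa only [hΦ, hω] using h₂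

/-- **(REP) in the END-STATE shape** `∀ p, C.IsPMinusKilledAlong e (-I • e_p)` (the `hk` binder of
`classPacksOf_pin_of_isPMinusKilledAlong` / `Model/E2InstanceR15A` at `e = BallForms.expP`). -/
theorem isPMinusKilledAlong_of_junction'
    {ω₁ : Representation ℂ (Ginf (Fin 2) Unit R S) (SchwartzMap (DPIdx (Fin 2) Unit R S → ℝ) ℂ)}
    (hW₁ : IsArchWeilDatum (ι𝕎 (Fin 2) Unit R S) ω₁)
    (χc : Ginf (Fin 2) Unit R S →* Circle) (hχc : Continuous χc)
    (e : (Fin 2 → ℂ) → X.G₁)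
    (L : SchwartzMap (DPIdx (Fin 2) Unit R S → ℝ) ℂ →L[ℂ] 𝓢((X.J → mixedSpace X.K), ℂ))
    (Φ₁ : Module.Dual ℂ X.W → SchwartzMap (DPIdx (Fin 2) Unit R S → ℝ) ℂ)
    (hΦ : ∀ ℓ, B.Φarch ℓ = L (Φ₁ ℓ))
    (hω : ∀ (b : Fin 2 → ℂ) (ℓ : Module.Dual ℂ X.W), B.ωinf (e b) (L (Φ₁ ℓ)) =
      L (charTwist (Circle.coeHom.comp χc) ω₁
        (((u21FrameEquiv (expP b) : UForm (Fin 2) Unit), (1 : UForm R S)) : Ginf (Fin 2) Unit R S) (Φ₁ ℓ)))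
    (hf : ∀ (p : Fin 2) ℓ, hypOpGen R S p () (Φ₁ ℓ) + I • rotBoostGen R S p () (Real.pi / 2) (Φ₁ ℓ) = 0) :
    ∀ p : Fin 2, B.IsPMinusKilledAlong e (-Complex.I • (Pi.single p 1 : Fin 2 → ℂ)) := fun p =>
  B.isPMinusKilledAlong_of_junction hW₁ χc hχc e L Φ₁ hΦ hω p (hf p)

/-! ### § 2 From the big archimedean datum: `χ`, `L` and the intertwining discharged by the factorisation -/

set_option backward.isDefEq.respectTransparency false in
/-- **(AN) from the big archimedean datum** `ω` of `G` on `𝓢(ℝ^{DPIdx ⊕ σ₂})`, the block inclusion `s` of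
`U(2,1) × U(R,S)`, an intertwiner `τ` into `C.ωinf` along the chart, and `Φarch ℓ = τ (Φ₁ ℓ ⊠ Φ₂)`. -/
theorem isWeaklyPDiff_of_blockPair {σ₂ : Type} [Fintype σ₂] [DecidableEq σ₂]
    {G : Type} [Group G] [TopologicalSpace G]
    {ι𝕎' : G →* symplecticGroup (polar (dotPairing (DPIdx (Fin 2) Unit R S ⊕ σ₂)))}
    {ω : Representation ℂ G (SchwartzMap (DPIdx (Fin 2) Unit R S ⊕ σ₂ → ℝ) ℂ)} (hW : IsArchWeilDatum ι𝕎' ω)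
    (hc : ∀ g, Continuous (ω g))
    {ω₁ : Representation ℂ (Ginf (Fin 2) Unit R S) (SchwartzMap (DPIdx (Fin 2) Unit R S → ℝ) ℂ)}
    (hW₁ : IsArchWeilDatum (ι𝕎 (Fin 2) Unit R S) ω₁) (hc₁ : ∀ u, Continuous (ω₁ u)) {ev : VacExponents}
    (hvac₁ : ∀ kk : DPK (Fin 2) Unit R S, ω₁ (κ (Fin 2) Unit R S kk) (hermitePi 0) = vacScalar ev kk • hermitePi 0)
    (s : Ginf (Fin 2) Unit R S →* G) (hs_cont : Continuous s)
    (hs : ∀ u, (⇑((ι𝕎' (s u)).1 :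
        ((DPIdx (Fin 2) Unit R S ⊕ σ₂ → ℝ) × (DPIdx (Fin 2) Unit R S ⊕ σ₂ → ℝ)) ≃ₗ[ℝ]
          (DPIdx (Fin 2) Unit R S ⊕ σ₂ → ℝ) × (DPIdx (Fin 2) Unit R S ⊕ σ₂ → ℝ)) :
        PhaseMap (DPIdx (Fin 2) Unit R S ⊕ σ₂)) =
      blockPhase (⇑((ι𝕎 (Fin 2) Unit R S u).1 :
        ((DPIdx (Fin 2) Unit R S → ℝ) × (DPIdx (Fin 2) Unit R S → ℝ)) ≃ₗ[ℝ]
          (DPIdx (Fin 2) Unit R S → ℝ) × (DPIdx (Fin 2) Unit R S → ℝ))) id)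
    (e : (Fin 2 → ℂ) → X.G₁)
    (τ : SchwartzMap (DPIdx (Fin 2) Unit R S ⊕ σ₂ → ℝ) ℂ →L[ℂ] 𝓢((X.J → mixedSpace X.K), ℂ))
    (hτ : ∀ (b : Fin 2 → ℂ) (x : SchwartzMap (DPIdx (Fin 2) Unit R S ⊕ σ₂ → ℝ) ℂ), B.ωinf (e b) (τ x) =
      τ (ω (s (((u21FrameEquiv (expP b) : UForm (Fin 2) Unit), (1 : UForm R S)) : Ginf (Fin 2) Unit R S)) x))
    (Φ₂ : SchwartzMap (σ₂ → ℝ) ℂ) (Φ₁ : Module.Dual ℂ X.W → SchwartzMap (DPIdx (Fin 2) Unit R S → ℝ) ℂ)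
    (hΦ : ∀ ℓ, B.Φarch ℓ = τ (SchwartzMap.sumProdLeftCLM Φ₂ (Φ₁ ℓ))) :
    B.IsWeaklyPDiff e := by
  obtain ⟨χc, hχc, hω⟩ := hW.exists_circle_twist_factorisation_clm hc hW₁ hc₁ s hs_cont hs τ
    (fun b => B.ωinf (e b))
    (fun b => (((u21FrameEquiv (expP b) : UForm (Fin 2) Unit), (1 : UForm R S)) : Ginf (Fin 2) Unit R S)) hτ Φ₂
  exact B.isWeaklyPDiff_of_junction hW₁ hvac₁ χc hχc e (τ.comp (SchwartzMap.sumProdLeftCLM Φ₂)) Φ₁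
    (fun ℓ => hΦ ℓ) (fun b ℓ => hω b (Φ₁ ℓ))

set_option backward.isDefEq.respectTransparency false in
/-- **(REP) along both `-i e_p` from the big archimedean datum**, given the harmonicity relations of the local
vectors `Φ₁ ℓ`. -/
theorem isPMinusKilledAlong_of_blockPair {σ₂ : Type} [Fintype σ₂] [DecidableEq σ₂]
    {G : Type} [Group G] [TopologicalSpace G]
    {ι𝕎' : G →* symplecticGroup (polar (dotPairing (DPIdx (Fin 2) Unit R S ⊕ σ₂)))}
    {ω : Representation ℂ G (SchwartzMap (DPIdx (Fin 2) Unit R S ⊕ σ₂ → ℝ) ℂ)} (hW : IsArchWeilDatum ι𝕎' ω)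
    (hc : ∀ g, Continuous (ω g))
    {ω₁ : Representation ℂ (Ginf (Fin 2) Unit R S) (SchwartzMap (DPIdx (Fin 2) Unit R S → ℝ) ℂ)}
    (hW₁ : IsArchWeilDatum (ι𝕎 (Fin 2) Unit R S) ω₁) (hc₁ : ∀ u, Continuous (ω₁ u))
    (s : Ginf (Fin 2) Unit R S →* G) (hs_cont : Continuous s)
    (hs : ∀ u, (⇑((ι𝕎' (s u)).1 :
        ((DPIdx (Fin 2) Unit R S ⊕ σ₂ → ℝ) × (DPIdx (Fin 2) Unit R S ⊕ σ₂ → ℝ)) ≃ₗ[ℝ]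
          (DPIdx (Fin 2) Unit R S ⊕ σ₂ → ℝ) × (DPIdx (Fin 2) Unit R S ⊕ σ₂ → ℝ)) :
        PhaseMap (DPIdx (Fin 2) Unit R S ⊕ σ₂)) =
      blockPhase (⇑((ι𝕎 (Fin 2) Unit R S u).1 :
        ((DPIdx (Fin 2) Unit R S → ℝ) × (DPIdx (Fin 2) Unit R S → ℝ)) ≃ₗ[ℝ]
          (DPIdx (Fin 2) Unit R S → ℝ) × (DPIdx (Fin 2) Unit R S → ℝ))) id)
    (e : (Fin 2 → ℂ) → X.G₁)
    (τ : SchwartzMap (DPIdx (Fin 2) Unit R S ⊕ σ₂ → ℝ) ℂ →L[ℂ] 𝓢((X.J → mixedSpace X.K), ℂ))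
    (hτ : ∀ (b : Fin 2 → ℂ) (x : SchwartzMap (DPIdx (Fin 2) Unit R S ⊕ σ₂ → ℝ) ℂ), B.ωinf (e b) (τ x) =
      τ (ω (s (((u21FrameEquiv (expP b) : UForm (Fin 2) Unit), (1 : UForm R S)) : Ginf (Fin 2) Unit R S)) x))
    (Φ₂ : SchwartzMap (σ₂ → ℝ) ℂ) (Φ₁ : Module.Dual ℂ X.W → SchwartzMap (DPIdx (Fin 2) Unit R S → ℝ) ℂ)
    (hΦ : ∀ ℓ, B.Φarch ℓ = τ (SchwartzMap.sumProdLeftCLM Φ₂ (Φ₁ ℓ)))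
    (hf : ∀ (p : Fin 2) ℓ, hypOpGen R S p () (Φ₁ ℓ) + I • rotBoostGen R S p () (Real.pi / 2) (Φ₁ ℓ) = 0) :
    ∀ p : Fin 2, B.IsPMinusKilledAlong e (-Complex.I • (Pi.single p 1 : Fin 2 → ℂ)) := by
  obtain ⟨χc, hχc, hω⟩ := hW.exists_circle_twist_factorisation_clm hc hW₁ hc₁ s hs_cont hs τ
    (fun b => B.ωinf (e b))
    (fun b => (((u21FrameEquiv (expP b) : UForm (Fin 2) Unit), (1 : UForm R S)) : Ginf (Fin 2) Unit R S)) hτ Φ₂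
  exact B.isPMinusKilledAlong_of_junction' hW₁ χc hχc e (τ.comp (SchwartzMap.sumProdLeftCLM Φ₂)) Φ₁
    (fun ℓ => hΦ ℓ) (fun b ℓ => hω b (Φ₁ ℓ)) hf

end ArchKTypeDataAt

end ArchJunction

/-! ## § 3 The constructor at an arbitrary rational centre -/

section Pin

variable (hHD : exists_isReal_hodgeModel) (hI : hodgePQ_independent_of_hodgeModel)
  (h₁ : BallQuotientUniformised)  (h₃ : CMAbelianVarietyRealised)

variable {L : CMField} {ι₁ : L →+* ℂ} {V : HermSpace3 L ι₁} {c : SeesawCtx L}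

variable (S : ThetaAdelicSide V c) (hV : IsAnisotropic L V.Hm) (k : Fin 4) (x : Fin 3 → ↥(maximalRealSubfield L)) (N : ℕ)
  (Γ₀ : Level V)
  (K : Subgroup (UnitaryGroup.finAdelic (↥(maximalRealSubfield L)) L (IsCMField.complexConj L) 3 V.Hm))
  (hK : (satLevelRegimeOf V hV K : Subgroup (V.latticeModel printFact_unitaryCompact_holds).G) ≤ S.Gfin)
  (hlevel : ∀ δ ∈ levelImage hHD hI h₁ h₃ Γ₀ hV, ∃ y : (V.latticeModel printFact_unitaryCompact_holds).G,
    y ∈ (satLevelRegimeOf V hV K : Subgroup (V.latticeModel printFact_unitaryCompact_holds).G) ∧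
      S.ιinf δ * y ∈ (V.latticeModel printFact_unitaryCompact_holds).Γ)
  (hsat : ∀ g ∈ (thetaSpaceInputIn hHD hI h₁ h₃ S hV).KΓ Γ₀,
    g ∈ (satLevelRegimeOf V hV K : Subgroup (V.latticeModel printFact_unitaryCompact_holds).G))
  (ωA : Representation ℂ U21 𝓢((Fin 3 → mixedSpace (↥(maximalRealSubfield L))), ℂ))
  (hA : ∀ g : U21, (S.P k).ω (S.ιinf g, 1) =
    adelicTensorEnd (K := ↥(maximalRealSubfield L)) (ι := Fin 3) (ωA g) LinearMap.id)
  (Φarch : Module.Dual ℂ (Fin 2 → ℂ) →ₗ[ℂ] 𝓢((Fin 3 → mixedSpace (↥(maximalRealSubfield L))), ℂ))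
  (hfix : ∀ y : (V.latticeModel printFact_unitaryCompact_holds).G,
    y ∈ (satLevelRegimeOf V hV K : Subgroup (V.latticeModel printFact_unitaryCompact_holds).G) →
    ∀ ℓ : Module.Dual ℂ (Fin 2 → ℂ),
    (S.P k).ω (y, 1) (testFun (↥(maximalRealSubfield L)) (Fin 3) (Φarch ℓ) x N) =
      testFun (↥(maximalRealSubfield L)) (Fin 3) (Φarch ℓ) x N)
  (harm : ∀ (u : ↥(stabilizer U21 x₀)) (ℓ : Module.Dual ℂ (Fin 2 → ℂ)),
    ωA (u : U21) (Φarch ℓ) = Φarch ((BallForms.isPullbackCocycle_cotangentCocycle.weightOf x₀).dual u ℓ))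

/-- **The archimedean `K`-type datum AT THE PIN, AT THE CENTRE `x`** (binder-1's currency `ArchKTypeDataAt`, thin coset
`finEmb x + (N)𝒪̂³`): finite `K`-type `satLevelRegimeOf V hV K`, `ωinf := ωA` the pure-tensor archimedean factor (`hA`), harmonic family
`Φarch`; hypotheses = the named junctions `hK`/`hlevel`/`hsat` (level), `hA` (product structure), `hfix` ((W-Kf′) at `x`), `harm` ((W-K∞′)). -/
def archKTypeOfAt :
    ArchKTypeDataAt (thetaSpaceInputIn hHD hI h₁ h₃ S hV) k (finEmb (↥(maximalRealSubfield L)) (Fin 3) x)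
      (Ideal.span {((N : ℕ) : 𝓞 (↥(maximalRealSubfield L)))}) where
  Γ₀ := Γ₀
  K₂ := ↥(satLevelRegimeOf V hV K)
  κ₂ := (satLevelRegimeOf V hV K).subtype
  comm m g := S.comm_fin g m.1 (hK m.2)
  level δ hδ := by
    obtain ⟨y, hy, h⟩ := hlevel δ hδ
    refine ⟨⟨y, hy⟩, ?_⟩
    show S.ιinf δ * y ∈ (S.P k).ΓU
    rw [S.hΓU k]
    exact h
  sat g hg := ⟨⟨g, hsat g hg⟩, rfl⟩
  Φarch := Φarch
  ωinf := ωA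
  fixN m ℓ := hfix m.1 m.2 ℓ
  prodN g Φinf := apply_testFun_of_eq_adelicTensorEnd (hA g) Φinf x N
  harm u ℓ := harm u ℓ

/-- (Ported verbatim from the HodgeCMPerL package; no docstring in the source.) -/
@[simp] theorem archKTypeOfAt_Γ₀ :
    (archKTypeOfAt hHD hI h₁ h₃ S hV k x N Γ₀ K hK hlevel hsat ωA hA Φarch hfix harm).Γ₀ = Γ₀ := rfl

/-- (Ported verbatim from the HodgeCMPerL package; no docstring in the source.) -/
@[simp] theorem archKTypeOfAt_Φarch :
    (archKTypeOfAt hHD hI h₁ h₃ S hV k x N Γ₀ K hK hlevel hsat ωA hA Φarch hfix harm).Φarch = Φarch := rfl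

/-- (Ported verbatim from the HodgeCMPerL package; no docstring in the source.) -/
@[simp] theorem archKTypeOfAt_ωinf :
    (archKTypeOfAt hHD hI h₁ h₃ S hV k x N Γ₀ K hK hlevel hsat ωA hA Φarch hfix harm).ωinf = ωA := rfl

/-- the adelic family of the term: `Φfam ℓ = φ_N(Φarch ℓ)` at the centre `x`. -/
theorem archKTypeOfAt_Φfam (ℓ : Module.Dual ℂ (Fin 2 → ℂ)) :
    (archKTypeOfAt hHD hI h₁ h₃ S hV k x N Γ₀ K hK hlevel hsat ωA hA Φarch hfix harm).Φfam ℓ =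
      testFun (↥(maximalRealSubfield L)) (Fin 3) (Φarch ℓ) x N := rfl

/-- **(AN) for the term ⇐ (AN) of `(ωA, Φarch)` along `e`.** -/
theorem isWeaklyPDiff_archKTypeOfAt {P' : Type*} [NormedAddCommGroup P'] [NormedSpace ℝ P'] (e : P' → U21)
    (h : ∀ (T : 𝓢((Fin 3 → mixedSpace (↥(maximalRealSubfield L))), ℂ) →L[ℂ] ℂ) (ℓ : Module.Dual ℂ (Fin 2 → ℂ)),
      DifferentiableAt ℝ (fun b => T (ωA (e b) (Φarch ℓ))) 0) :
    (archKTypeOfAt hHD hI h₁ h₃ S hV k x N Γ₀ K hK hlevel hsat ωA hA Φarch hfix harm).IsWeaklyPDiff e :=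
  fun T ℓ => h T ℓ

/-- **(REP) along `v` for the term ⇐ the p⁻-limits of `(ωA, Φarch)`.** -/
theorem isPMinusKilledAlong_archKTypeOfAt {P' : Type*} [NormedAddCommGroup P'] [NormedSpace ℝ P'] [Module ℂ P']
    (e : P' → U21) (v : P')
    (h : ∀ ℓ : Module.Dual ℂ (Fin 2 → ℂ), ∃ D Dᵢ : 𝓢((Fin 3 → mixedSpace (↥(maximalRealSubfield L))), ℂ),
      Tendsto (fun t : ℝ => t⁻¹ • (ωA (e (t • v)) (Φarch ℓ) - Φarch ℓ)) (𝓝[≠] 0) (𝓝 D) ∧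
        Tendsto (fun t : ℝ => t⁻¹ • (ωA (e (t • (Complex.I • v))) (Φarch ℓ) - Φarch ℓ)) (𝓝[≠] 0) (𝓝 Dᵢ) ∧
          D + Complex.I • Dᵢ = 0) :
    (archKTypeOfAt hHD hI h₁ h₃ S hV k x N Γ₀ K hK hlevel hsat ωA hA Φarch hfix harm).IsPMinusKilledAlong e v :=
  fun ℓ => h ℓ

/-- **rows 14/15 TRANSFER from any x₀-pinned datum with the same archimedean pair** `(ωinf, Φarch) = (ωA, Φarch)` (e.g. the
RUN-43/45 `archKTypeOfSide…G` terms): the three archimedean predicates do not see the centre. -/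
theorem isWeaklyPDiff_archKTypeOfAt_of_eq {N' : ℕ} (C : ArchKTypeData (thetaSpaceInputIn hHD hI h₁ h₃ S hV) k N')
    (hω : ∀ g Φ, C.ωinf g Φ = ωA g Φ) (hΦ : ∀ ℓ, C.Φarch ℓ = Φarch ℓ)
    {P' : Type*} [NormedAddCommGroup P'] [NormedSpace ℝ P'] (e : P' → U21) (h : C.IsWeaklyPDiff e) :
    (archKTypeOfAt hHD hI h₁ h₃ S hV k x N Γ₀ K hK hlevel hsat ωA hA Φarch hfix harm).IsWeaklyPDiff e :=
  fun T ℓ => by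
    have h' := h T ℓ
    simp only [hω, hΦ] at h'
    exact h'

/-- (Ported verbatim from the HodgeCMPerL package; no docstring in the source.) -/
theorem isPMinusKilledAlong_archKTypeOfAt_of_eq {N' : ℕ} (C : ArchKTypeData (thetaSpaceInputIn hHD hI h₁ h₃ S hV) k N')
    (hω : ∀ g Φ, C.ωinf g Φ = ωA g Φ) (hΦ : ∀ ℓ, C.Φarch ℓ = Φarch ℓ)
    {P' : Type*} [NormedAddCommGroup P'] [NormedSpace ℝ P'] [Module ℂ P'] (e : P' → U21) (v : P')
    (h : C.IsPMinusKilledAlong e v) :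
    (archKTypeOfAt hHD hI h₁ h₃ S hV k x N Γ₀ K hK hlevel hsat ωA hA Φarch hfix harm).IsPMinusKilledAlong e v :=
  fun ℓ => by
    obtain ⟨D, Dᵢ, hD, hDᵢ, hsum⟩ := h ℓ
    simp only [hω, hΦ] at hD hDᵢ
    exact ⟨D, Dᵢ, hD, hDᵢ, hsum⟩

end Pin

end Model
end HodgeCM

end
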